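import Summits.AtomisticToContinuum.HydrodynamicLimit.Theorems.LambertianContactSwapLambertianEulerStarShellsTools
import HarnessLib

/-!
# A star of velocity shells under the free rung-0 product law
# (`LambertianContactSwap.LambertianEuler`, stmt-AtomisticToContinuum-11854, line `Sketch`; lead c10,
# piece W3 `StarShells`, part 2 of 2: registered stub `pi_starShells_le`)

Static estimate for lead c10's concentration theorem.  Under the FREE rung-0 law
`U_n := ⊗_{i < n} (Haar ⊗ N(w, ϑ id))` on `Config n (Fin 3) 𝕋³` (positions i.i.d. Haar on `𝕋³`,
velocities i.i.d. Gaussian `gaussMeasure w ϑ`, all particles independent), the velocity SHELL of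
width `δ` of the ordered pair `(a, b)` is the event `ε ≤ d(x_a, x_b) ≤ ε + δ ‖v_a − v_b‖`
(minimal-image distance, `Torus.norm_geometry_sepVec`).  For a STAR of `m` shells with common centre
`a`, distinct leaves `bs i ≠ a` and widths `δs i ≤ ε ≤ 1/4`, weighted by
`(1 + ‖v_a‖ + Σ_i ‖v_{bs i}‖)^{n'}`,

  `∫⁻ 𝟙{star} · (1 + ‖v_a‖ + Σ_i ‖v_{bs i}‖)^{n'} dU_n ≤ C ε^{2m} Π_i δs i`,
  `C = C(w, ϑ, m, n')` (`pi_starShells_le`; used with `m = 1, 2` by the lead after pulling the rung-0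
  Gibbs law back to `U_n` by the insertion bound `…GibbsInsertionZip.localGibbsLaw_le_pow_mul_pi`).

Proof (tools in `…StarShellsTools`): the weight is dominated by the product
`(1 + ‖v_a‖)^{n'} Π_i (1 + ‖v_{bs i}‖)^{n'}` (`one_add_add_sum_le`) and the star indicator is the
product of the `m` shell indicators, so the integrand is a centre factor times a product of leaf
factors; the star factorisation `lintegral_pi_centre_mul_prod_eq` (Tonelli over `Measure.pi`, one
leaf at a time) reduces to the leaf bound `lintegral_leafShell_le`
(`≤ (3v₁+64) ε² δ_i (1 + ‖v_a‖)³ M_{n'+3}`, from the shell section `volume_sepVec_shell_le`) and the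
Gaussian moment `M_{n'+3m}` of the centre; `C := ((3v₁+64) M_{n'+3})^m M_{n'+3m}`,
`M_p = ∫ (1 + ‖v‖)^p dN(w, ϑ id)`.

References: Cercignani–Illner–Pulvirenti 1994 §2.2 (collision cylinders and shells);
Gallagher–Saint-Raymond–Texier 2013, Lemma 4.1.2.  All statements [folklore].
-/

noncomputable section

namespace Summit.AtomisticToContinuum.HydrodynamicLimit.Theorems.LambertianContactSwapLambertianEulerStarShells

open scoped BigOperators Topology ENNReal InnerProductSpace
open MeasureTheory ProbabilityTheory Filter Set
open Literature.MathematicalPhysics.KineticTheory Literature.MathematicalPhysics.StatisticalMechanics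
open Literature.Analysis.FluidPDE
open Summit.AtomisticToContinuum.HydrodynamicLimit.Theorems.LambertianContactSwapLambertianEulerStarShellsTools

/-! ## The star estimate -/

/-- **A weighted star of velocity shells under the free rung-0 product law** (registered stub
`pi_starShells_le` of lead c10).  For every drift `w`, temperature parameter `ϑ`, number of leaves `m`
and weight exponent `n'` there is `C = C(w, ϑ, m, n') > 0` such that for all `n`, `0 < ε ≤ 1/4`, every
centre `a : Fin n`, distinct leaves `bs i ≠ a` and widths `0 ≤ δs i ≤ ε`:
`∫⁻ 𝟙{∀ i, ε ≤ d(x_a, x_{bs i}) ≤ ε + δs i ‖v_a − v_{bs i}‖} (1 + ‖v_a‖ + Σ_i ‖v_{bs i}‖)^{n'} dU_n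
  ≤ C ε^{2m} Π_i δs i`, `U_n = ⊗_{i<n} (Haar ⊗ N(w, ϑ id))`
(domination of the weight by `(1 + ‖v_a‖)^{n'} Π_i (1 + ‖v_{bs i}‖)^{n'}`, the star factorisation
`lintegral_pi_centre_mul_prod_eq`, the leaf bound `lintegral_leafShell_le` and the Gaussian moment of
the centre; `C = ((3v₁ + 64) M_{n'+3})^m M_{n'+3m}`, `M_p = ∫ (1 + ‖v‖)^p dN(w, ϑ id)`). [folklore] -/
theorem pi_starShells_le :
    ∀ (w : V3) (ϑ : ℝ) (m n' : ℕ), ∃ C : ℝ, 0 < C ∧ ∀ (n : ℕ) (ε : ℝ), 0 < ε → ε ≤ 1 / 4 →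
      ∀ (a : Fin n) (bs : Fin m → Fin n), Function.Injective bs → (∀ i, bs i ≠ a) →
      ∀ δs : Fin m → ℝ, (∀ i, 0 ≤ δs i) → (∀ i, δs i ≤ ε) →
        ∫⁻ y, {y : Config n (Fin 3) T3 | ∀ i, ε ≤ ‖(Torus.geometry (Fin 3)).sepVec (y a).1 (y (bs i)).1‖ ∧
                ‖(Torus.geometry (Fin 3)).sepVec (y a).1 (y (bs i)).1‖ ≤ ε + δs i * ‖(y a).2 - (y (bs i)).2‖}.indicator
              (fun y => ENNReal.ofReal ((1 + ‖(y a).2‖ + ∑ i, ‖(y (bs i)).2‖) ^ n')) y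
          ∂Measure.pi (fun _ : Fin n => (volume : Measure T3).prod (gaussMeasure w ϑ)) ≤
        ENNReal.ofReal (C * ε ^ (2 * m) * ∏ i, δs i) := by
  intro w ϑ m n'
  -- the constants: `K = 3 v₁ + 64` and the Gaussian moments `M₁ = M_{n'+3}`, `M₂ = M_{n'+3m}`
  obtain ⟨M₁, hM₁⟩ : ∃ M : ℝ, ∫ v, (1 + ‖v‖) ^ (n' + 3) ∂gaussMeasure w ϑ = M := ⟨_, rfl⟩
  obtain ⟨M₂, hM₂⟩ : ∃ M : ℝ, ∫ v, (1 + ‖v‖) ^ (n' + 3 * m) ∂gaussMeasure w ϑ = M := ⟨_, rfl⟩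
  have hM₁1 : 1 ≤ M₁ := hM₁ ▸ one_le_integral_one_add_norm_pow w ϑ _
  have hM₂1 : 1 ≤ M₂ := hM₂ ▸ one_le_integral_one_add_norm_pow w ϑ _
  have hv := v₁_pos
  have hK : 0 < 3 * v₁ + 64 := by positivity
  have hM₁0 : 0 < M₁ := by linarith
  have hM₂0 : 0 < M₂ := by linarith
  refine ⟨((3 * v₁ + 64) * M₁) ^ m * M₂, by positivity, ?_⟩
  intro n ε hε hε4 a bs hbs hba δs hδ0 hδε
  -- the dominating product of one-coordinate factors
  set F : T3 × V3 → ℝ≥0∞ := fun z => ENNReal.ofReal ((1 + ‖z.2‖) ^ n') with hF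
  set G : Fin m → T3 × V3 → T3 × V3 → ℝ≥0∞ := fun i z q =>
    {q : T3 × V3 | ε ≤ ‖(Torus.geometry (Fin 3)).sepVec z.1 q.1‖ ∧
        ‖(Torus.geometry (Fin 3)).sepVec z.1 q.1‖ ≤ ε + δs i * ‖z.2 - q.2‖}.indicator
      (fun q => ENNReal.ofReal ((1 + ‖q.2‖) ^ n')) q with hG
  have hFm : Measurable F :=
    ENNReal.measurable_ofReal.comp ((measurable_const.add measurable_snd.norm).pow_const n')
  have hGm : ∀ i, Measurable (Function.uncurry (G i)) := by
    intro i
    have hd : Measurable fun p : (T3 × V3) × (T3 × V3) =>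
        ‖(Torus.geometry (Fin 3)).sepVec p.1.1 p.2.1‖ :=
      (Torus.measurable_geometry_sepVec.comp
        ((measurable_fst.comp measurable_fst).prodMk (measurable_fst.comp measurable_snd))).norm
    have hr : Measurable fun p : (T3 × V3) × (T3 × V3) => ε + δs i * ‖p.1.2 - p.2.2‖ :=
      measurable_const.add (((measurable_snd.comp measurable_fst).sub
        (measurable_snd.comp measurable_snd)).norm.const_mul _)
    have hS : MeasurableSet {p : (T3 × V3) × (T3 × V3) |
        ε ≤ ‖(Torus.geometry (Fin 3)).sepVec p.1.1 p.2.1‖ ∧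
          ‖(Torus.geometry (Fin 3)).sepVec p.1.1 p.2.1‖ ≤ ε + δs i * ‖p.1.2 - p.2.2‖} :=
      (measurableSet_le measurable_const hd).inter (measurableSet_le hd hr)
    have hh : Measurable fun p : (T3 × V3) × (T3 × V3) => ENNReal.ofReal ((1 + ‖p.2.2‖) ^ n') :=
      ENNReal.measurable_ofReal.comp
        ((measurable_const.add (measurable_snd.comp measurable_snd).norm).pow_const n')
    have heq : Function.uncurry (G i) =
        {p : (T3 × V3) × (T3 × V3) | ε ≤ ‖(Torus.geometry (Fin 3)).sepVec p.1.1 p.2.1‖ ∧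
          ‖(Torus.geometry (Fin 3)).sepVec p.1.1 p.2.1‖ ≤ ε + δs i * ‖p.1.2 - p.2.2‖}.indicator
          fun p => ENNReal.ofReal ((1 + ‖p.2.2‖) ^ n') := by
      funext p
      simp only [hG, Function.uncurry, Set.indicator_apply, mem_setOf_eq]
    rw [heq]
    exact hh.indicator hS
  -- pointwise domination of the weighted star indicator
  have hpt : ∀ y : Config n (Fin 3) T3,
      {y : Config n (Fin 3) T3 | ∀ i, ε ≤ ‖(Torus.geometry (Fin 3)).sepVec (y a).1 (y (bs i)).1‖ ∧
          ‖(Torus.geometry (Fin 3)).sepVec (y a).1 (y (bs i)).1‖ ≤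
            ε + δs i * ‖(y a).2 - (y (bs i)).2‖}.indicator
        (fun y => ENNReal.ofReal ((1 + ‖(y a).2‖ + ∑ i, ‖(y (bs i)).2‖) ^ n')) y ≤
      F (y a) * ∏ i, G i (y a) (y (bs i)) := by
    intro y
    by_cases hy : y ∈ {y : Config n (Fin 3) T3 |
        ∀ i, ε ≤ ‖(Torus.geometry (Fin 3)).sepVec (y a).1 (y (bs i)).1‖ ∧
          ‖(Torus.geometry (Fin 3)).sepVec (y a).1 (y (bs i)).1‖ ≤
            ε + δs i * ‖(y a).2 - (y (bs i)).2‖}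
    · rw [Set.indicator_of_mem hy]
      have hy' := hy
      simp only [mem_setOf_eq] at hy'
      have hGi : ∀ i, G i (y a) (y (bs i)) = ENNReal.ofReal ((1 + ‖(y (bs i)).2‖) ^ n') := by
        intro i
        simp only [hG]
        rw [Set.indicator_of_mem]
        exact hy' i
      simp only [hGi, hF]
      rw [← ENNReal.ofReal_prod_of_nonneg (f := fun i => (1 + ‖(y (bs i)).2‖) ^ n')
          fun i _ => by positivity,
        ← ENNReal.ofReal_mul (by positivity), Finset.prod_pow, ← mul_pow]
      refine ENNReal.ofReal_le_ofReal (pow_le_pow_left₀ (by positivity) ?_ n')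
      exact one_add_add_sum_le (norm_nonneg _) m (fun i => ‖(y (bs i)).2‖) fun i => norm_nonneg _
    · rw [Set.indicator_of_notMem hy]
      exact zero_le
  -- each leaf integral
  have hleaf : ∀ (i : Fin m) (z : T3 × V3),
      ∫⁻ q, G i z q ∂(volume : Measure T3).prod (gaussMeasure w ϑ) ≤
        ENNReal.ofReal ((3 * v₁ + 64) * ε ^ 2 * δs i * (1 + ‖z.2‖) ^ 3 * M₁) := by
    intro i z
    rw [← hM₁]
    simp only [hG]
    exact lintegral_leafShell_le w ϑ n' hε hε4 (hδ0 i) (hδε i) z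
  -- measurability of the centre moment
  have hmz : Measurable fun z : T3 × V3 => ENNReal.ofReal ((1 + ‖z.2‖) ^ (n' + 3 * m)) :=
    ENNReal.measurable_ofReal.comp ((measurable_const.add measurable_snd.norm).pow_const _)
  have hmv : Measurable fun v : V3 => ENNReal.ofReal ((1 + ‖v‖) ^ (n' + 3 * m)) :=
    ENNReal.measurable_ofReal.comp ((measurable_const.add measurable_norm).pow_const _)
  have hPnn : 0 ≤ ∏ i, ((3 * v₁ + 64) * M₁ * ε ^ 2 * δs i) :=
    Finset.prod_nonneg fun i _ => by have := hδ0 i; positivity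
  -- pointwise: the centre factor times the leaf bounds is a single moment
  have hcentre : ∀ z : T3 × V3,
      F z * ∏ i, ENNReal.ofReal ((3 * v₁ + 64) * ε ^ 2 * δs i * (1 + ‖z.2‖) ^ 3 * M₁) =
        ENNReal.ofReal (∏ i, ((3 * v₁ + 64) * M₁ * ε ^ 2 * δs i)) *
          ENNReal.ofReal ((1 + ‖z.2‖) ^ (n' + 3 * m)) := by
    intro z
    have hfac : ∀ i ∈ (Finset.univ : Finset (Fin m)),
        (3 * v₁ + 64) * ε ^ 2 * δs i * (1 + ‖z.2‖) ^ 3 * M₁ =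
          ((3 * v₁ + 64) * M₁ * ε ^ 2 * δs i) * (1 + ‖z.2‖) ^ 3 := fun i _ => by ring
    simp only [hF]
    rw [← ENNReal.ofReal_prod_of_nonneg
        (f := fun i => (3 * v₁ + 64) * ε ^ 2 * δs i * (1 + ‖z.2‖) ^ 3 * M₁)
        fun i _ => by have := hδ0 i; positivity,
      ← ENNReal.ofReal_mul (by positivity), ← ENNReal.ofReal_mul hPnn,
      Finset.prod_congr rfl hfac, Finset.prod_mul_distrib, Finset.prod_const, Finset.card_univ,
      Fintype.card_fin, pow_add, pow_mul]
    congr 1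
    ring
  calc ∫⁻ y, {y : Config n (Fin 3) T3 |
          ∀ i, ε ≤ ‖(Torus.geometry (Fin 3)).sepVec (y a).1 (y (bs i)).1‖ ∧
            ‖(Torus.geometry (Fin 3)).sepVec (y a).1 (y (bs i)).1‖ ≤
              ε + δs i * ‖(y a).2 - (y (bs i)).2‖}.indicator
          (fun y => ENNReal.ofReal ((1 + ‖(y a).2‖ + ∑ i, ‖(y (bs i)).2‖) ^ n')) y
          ∂Measure.pi (fun _ : Fin n => (volume : Measure T3).prod (gaussMeasure w ϑ))
      ≤ ∫⁻ y, F (y a) * ∏ i, G i (y a) (y (bs i))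
          ∂Measure.pi (fun _ : Fin n => (volume : Measure T3).prod (gaussMeasure w ϑ)) :=
        lintegral_mono hpt
    _ = ∫⁻ z, F z * ∏ i, ∫⁻ q, G i z q ∂(volume : Measure T3).prod (gaussMeasure w ϑ)
          ∂(volume : Measure T3).prod (gaussMeasure w ϑ) :=
        lintegral_pi_centre_mul_prod_eq _ a m bs hbs hba F hFm G hGm
    _ ≤ ∫⁻ z, F z * ∏ i, ENNReal.ofReal ((3 * v₁ + 64) * ε ^ 2 * δs i * (1 + ‖z.2‖) ^ 3 * M₁)
          ∂(volume : Measure T3).prod (gaussMeasure w ϑ) :=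
        lintegral_mono fun z => mul_le_mul_right (Finset.prod_le_prod' fun i _ => hleaf i z) _
    _ = ∫⁻ z, ENNReal.ofReal (∏ i, ((3 * v₁ + 64) * M₁ * ε ^ 2 * δs i)) *
          ENNReal.ofReal ((1 + ‖z.2‖) ^ (n' + 3 * m))
          ∂(volume : Measure T3).prod (gaussMeasure w ϑ) := lintegral_congr hcentre
    _ = ENNReal.ofReal (∏ i, ((3 * v₁ + 64) * M₁ * ε ^ 2 * δs i)) *
          ∫⁻ v, ENNReal.ofReal ((1 + ‖v‖) ^ (n' + 3 * m)) ∂gaussMeasure w ϑ := by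
        rw [lintegral_const_mul _ hmz,
          (measurePreserving_snd (μ := (volume : Measure T3)) (ν := gaussMeasure w ϑ)).lintegral_comp
            hmv]
    _ = ENNReal.ofReal ((∏ i, ((3 * v₁ + 64) * M₁ * ε ^ 2 * δs i)) * M₂) := by
        rw [lintegral_one_add_norm_pow, hM₂, ← ENNReal.ofReal_mul hPnn]
    _ = ENNReal.ofReal (((3 * v₁ + 64) * M₁) ^ m * M₂ * ε ^ (2 * m) * ∏ i, δs i) := by
        congr 1
        rw [Finset.prod_mul_distrib, Finset.prod_const, Finset.card_univ, Fintype.card_fin]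
        simp only [mul_pow]
        ring

end Summit.AtomisticToContinuum.HydrodynamicLimit.Theorems.LambertianContactSwapLambertianEulerStarShells

end
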